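import Mathlib.Analysis.InnerProductSpace.Basic
import Mathlib.Tactic.Module
import HarnessLib

/-!
# Soundness lemma (L0) for the certificate checker `capcc`: cube-face charts cover all directions, cells are convex hulls of their corners
# (crux `CoaxialWallLaw`, stmt-Ventures-19481)

HONEST FRAMING. Venture `Summits/Ventures/Crystal3D` (cell `crystal3d-full`); helper `--supports` the crux `CoaxialWallLaw`
(stmt-Ventures-19481, `route-Ventures-StickyWulffConstant`), registered line 'CoaxialWallLawCertificates' (planner cf-p1, stub
`stub_lensCert`); fifth file of the checker-soundness series.  SOURCE: cf-p2's certificate schema v1, PREREG (69.0⁷) S-2 `Node` / CHECK T1,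
S-3 (L0): «every direction has a representative point in some leaf cell (scale `u` by `1/max |uᵢ|`)», and (L2)'s premise «cells are convex
hulls of their corners».  The quadtree lives on the six faces `{m : m[axis] = ±1, other coordinates (s, t) ∈ [−1, 1]²}` of the cube in
(module) coordinates; a cell is `face × [s₀, s₁] × [t₀, t₁]`, its corners the four points with `s ∈ {s₀, s₁}`, `t ∈ {t₀, t₁}`.
* **`exists_face_rep`** (L0, coordinates `Fin 3 → ℝ`): every `m ≠ 0` has a positive multiple `c • m` on a face: some coordinate equals
  `±1` and all coordinates lie in `[−1, 1]`.  (The checker transports directions of the ambient space to coordinates by its linear chart;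
  positive scaling does not change a direction.)
* `mem_Icc_split` — a point of `[s₀, s₁]` lies in `[s₀, m]` or in `[m, s₁]` for any `m` between (the SPLIT step, CHECK T1).
* **`bilinear_convex_weights`** (any real vector space): for an affine chart `P s t = F + s•A + t•B` and `s ∈ [s₀, s₁]`, `t ∈ [t₀, t₁]`
  (`s₀ < s₁`, `t₀ < t₁`) the point `P s t` is the convex combination of the four corners with the bilinear weights
  `(1−λ)(1−μ), (1−λ)μ, λ(1−μ), λμ` (`λ = (s−s₀)/(s₁−s₀)`, `μ = (t−t₀)/(t₁−t₀)`) — stated with a `Fin 4`-indexed weight vector summing to `1`,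
  the input shape of `CapChecker.cellInCap_le` / `cellInCap_lt` / `cellsConflict` / `cone_convex`.
WHAT THIS IS NOT: not the checker's tree recursion (that is `checkMember_sound`'s induction over `Node`s); no metric statement; F-C1 not moved.
-/

namespace Summit.Ventures.Crystal3D.Theorems

namespace CapChecker

open Finset

/-! ### (L0) Every direction has a representative on a cube face -/

/-- **(L0) face representative.**  A nonzero coordinate vector `m : Fin 3 → ℝ` has a positive multiple on the boundary of the cube
`[−1, 1]³`: for `c = 1 / max |mᵢ|`, some coordinate of `c • m` is `±1` and all are in `[−1, 1]`. -/
theorem exists_face_rep (m : Fin 3 → ℝ) (hm : m ≠ 0) :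
    ∃ (i : Fin 3) (σ c : ℝ), (σ = 1 ∨ σ = -1) ∧ 0 < c ∧ c * m i = σ ∧ ∀ j, |c * m j| ≤ 1 := by
  obtain ⟨i, -, hi⟩ := Finset.exists_max_image Finset.univ (fun j => |m j|) Finset.univ_nonempty
  have hMpos : 0 < |m i| := by
    by_contra h
    push Not at h
    apply hm
    funext j
    have hj : |m j| ≤ |m i| := hi j (Finset.mem_univ j)
    have : |m j| = 0 := le_antisymm (hj.trans h) (abs_nonneg _)
    exact abs_eq_zero.1 this
  refine ⟨i, if 0 ≤ m i then 1 else -1, |m i|⁻¹, ?_, inv_pos.2 hMpos, ?_, ?_⟩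
  · by_cases h : 0 ≤ m i
    · exact Or.inl (if_pos h)
    · exact Or.inr (if_neg h)
  · by_cases h : 0 ≤ m i
    · rw [if_pos h, abs_of_nonneg h, inv_mul_cancel₀ (by rw [abs_of_nonneg h] at hMpos; exact hMpos.ne')]
    · push Not at h
      rw [if_neg (not_le.2 h), abs_of_neg h, ← neg_inv, neg_mul, inv_mul_cancel₀ h.ne]
  · intro j
    rw [abs_mul, abs_inv, abs_abs, inv_mul_le_iff₀ hMpos, mul_one]
    exact hi j (Finset.mem_univ j)

/-- **SPLIT step.**  A point of `[s₀, s₁]` lies in `[s₀, c]` or in `[c, s₁]`. -/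
theorem mem_Icc_split {s₀ s₁ c s : ℝ} (hs : s ∈ Set.Icc s₀ s₁) :
    s ∈ Set.Icc s₀ c ∨ s ∈ Set.Icc c s₁ := by
  rcases le_total s c with h | h
  · exact Or.inl ⟨hs.1, h⟩
  · exact Or.inr ⟨h, hs.2⟩

/-! ### Cells are convex hulls of their corners -/

section Bilinear

variable {W : Type*} [AddCommGroup W] [Module ℝ W]

/-- **Cells are convex hulls of their corners.**  For the affine chart `P s t = F + s • A + t • B` of a face and a parameter point
`(s, t) ∈ [s₀, s₁] × [t₀, t₁]` (`s₀ < s₁`, `t₀ < t₁`): with the bilinear weights `w` (nonnegative, summing to `1`) and the corners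
`p = (P s₀ t₀, P s₀ t₁, P s₁ t₀, P s₁ t₁)` one has `∑ wᵢ • pᵢ = P s t`. -/
theorem bilinear_convex_weights (F A B : W) {s₀ s₁ t₀ t₁ s t : ℝ} (hs : s₀ < s₁) (ht : t₀ < t₁)
    (hss : s ∈ Set.Icc s₀ s₁) (htt : t ∈ Set.Icc t₀ t₁) :
    ∃ w : Fin 4 → ℝ, (∀ i, 0 ≤ w i) ∧ (∑ i, w i = 1) ∧
      (∑ i, w i • ![F + s₀ • A + t₀ • B, F + s₀ • A + t₁ • B, F + s₁ • A + t₀ • B, F + s₁ • A + t₁ • B] i) =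
        F + s • A + t • B := by
  set lam := (s - s₀) / (s₁ - s₀) with hlam
  set mu := (t - t₀) / (t₁ - t₀) with hmu
  have hds : 0 < s₁ - s₀ := sub_pos.2 hs
  have hdt : 0 < t₁ - t₀ := sub_pos.2 ht
  have hl0 : 0 ≤ lam := div_nonneg (sub_nonneg.2 hss.1) hds.le
  have hl1 : lam ≤ 1 := (div_le_one hds).2 (sub_le_sub_right hss.2 _)
  have hm0 : 0 ≤ mu := div_nonneg (sub_nonneg.2 htt.1) hdt.le
  have hm1 : mu ≤ 1 := (div_le_one hdt).2 (sub_le_sub_right htt.2 _)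
  have hsl : s = s₀ + lam * (s₁ - s₀) := by rw [hlam, div_mul_cancel₀ _ hds.ne']; ring
  have htm : t = t₀ + mu * (t₁ - t₀) := by rw [hmu, div_mul_cancel₀ _ hdt.ne']; ring
  refine ⟨![(1 - lam) * (1 - mu), (1 - lam) * mu, lam * (1 - mu), lam * mu], ?_, ?_, ?_⟩
  · intro i
    fin_cases i
    · exact mul_nonneg (sub_nonneg.2 hl1) (sub_nonneg.2 hm1)
    · exact mul_nonneg (sub_nonneg.2 hl1) hm0
    · exact mul_nonneg hl0 (sub_nonneg.2 hm1)
    · exact mul_nonneg hl0 hm0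
  · rw [Fin.sum_univ_four]
    simp only [Matrix.cons_val_zero, Matrix.cons_val_one, Matrix.cons_val]
    ring
  · rw [Fin.sum_univ_four]
    simp only [Matrix.cons_val_zero, Matrix.cons_val_one, Matrix.cons_val]
    rw [hsl, htm]
    module

end Bilinear

end CapChecker

end Summit.Ventures.Crystal3D.Theorems
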